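import Summits.QuantumFields.BalabanUV.Beta.FP.PerfectPropagatorKernel
import Summits.QuantumFields.BalabanUV.Beta.GAN24.LatticeKernelReality

/-!
# `BalabanUV.Beta.FP.PerfectPropagatorKernelSymm` — road «FP» for binder row D1, leaf H2-P, row **H2-P-KER-ASM v1**, part (K4): STRUCTURE of the remainder kernel —
# `KB` is REAL (`conj KB = KB`) and REFLECTION-HERMITIAN (`KB α β (−z) = KB β α z`), from the hyperoctahedral evenness of `W_∞`, the conjugation structure of the
# Feynman-completed symbol and the Hermitian inverse

HONEST DEPENDENCY (page 1, mandatory): continuum YM on T⁴ ⇐ BetaPertH ∧ nine spine estimates (0/9 proved); BetaPertH ⇐ (D1) ∧ (D4) ∧ CAP+tail;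
G-an2-4 gates asym, D1 and NE2/3/4.  HONEST FRAMING (cell contract, verbatim): «discharging `BetaPertH` makes Bałaban's UV stability UNCONDITIONAL —
a real constructive-QFT result; it is NOT the continuum limit and NOT the Clay problem.»  THIS MODULE DISCHARGES NOTHING of the wall: [folklore] matrix ∕ measure algebra
over the data defs of `FP/PerfectPropagatorKernel` (p238743) and `FP/PerfectPropagatorSymbol` (p231001), with `PerfectSymbolPerm.W166Inf_cflip` (d1-formalise-leaf-01)
BY NAME, and gan24's generic `GAN24.LatticeKernelReality` (reality ∕ reflection of lattice kernels from the real-zone symmetry of the symbol).  No `def`, no `def … : Prop`,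
nothing cited, 0 sorry; 0 wall binders; NOT D1, NOT BetaPertH, NOT continuum, NOT Clay.

ABSOLUTE RULE (cell charter, verbatim): «No internally-minted statement may enter as a cited fact. Every hypothesis is either kernel-proved in this package or a
verbatim quotation of a PUBLISHED theorem with page reference. The manuscript(s) under audit are NOT citable for their own disputed steps — they are the thing
under adjudication; programme-internal (2001/route/tribunal) claims are never citable.»

WHAT (lattice dimension `d + 1`):
* §1 [folklore] **`W166Inf_neg : W_∞(μ,ν; −p) = W_∞(μ,ν; p)`** for every complex `p` (the coordinate flips `W166Inf_cflip` composed over a `Finset` of coordinates).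
* §2 [folklore] the conjugation structure: `d1Sym_neg` (`p̂(−s) = conj p̂(s)`), `curlRow_star`, `maxwellMat_star` ∕ `feynMat_star` (`feynMat W (conj ph) = conj ∘ feynMat W ph`),
  `map_conj_eq_conjTranspose_transpose`, `inv_map_conj` (`(conj ∘ M)⁻¹ = conj ∘ M⁻¹`), hence **`PinfSym_neg : PinfSym (−s) (p̂(−s)) = conj ∘ PinfSym s (p̂ s)`**,
  `dispersion_neg`, **`symB_ofRealVec_neg : B(−s) = conj B(s)`**; Hermitian: **`conj_symB_ofRealVec : conj (B_{αβ}(s)) = B_{βα}(s)`** (`Matrix.IsHermitian.inv`; cf. `FP/ResidualModeSymbols.PinfSym_isHermitian`).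
* §3 **(K4)** through gan24's GENERIC reality ∕ reflection theorems (`GAN24.LatticeKernelReality.latticeKernel_im_eq_zero`, `latticeKernel_reflect`, BY NAME):
  `im_KB : Im (KB α β z) = 0`, **`conj_KB : conj (KB α β z) = KB α β z`**, `KB_eq_re`, **`KB_neg : KB α β (−z) = KB β α z`**.
Provenance: G-an2-4 swarm leaf prover 05, gen 35 (prover-b2b-balaban-gan24-formalise-leaf-05-g35-0), cross-lane on road FP (INTENT l.21819, owner GO l.21970), 2026-08-20.
-/

noncomputable section

namespace Summit.QuantumFields.BalabanUV.Beta.FP.PerfectPropagatorKernelSymm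

open MeasureTheory Set Complex Filter Finset Matrix
open scoped Real BigOperators ComplexConjugate
open Literature.MathematicalPhysics.QuantumFieldTheory.Balaban1983to89
open B4Strip (ofRealVec)
open B4ContourShift (BZ phase integrand fourierBox latticeKernel phase_eq_ofReal norm_cexp_phase)
open B5Prop11Fiber (d1Sym)
open Literature.Probability.LatticeModels (dispersion)
open Summit.QuantumFields.BalabanUV.Beta.FP.PerfectSymbol166 (W166Inf)
open Summit.QuantumFields.BalabanUV.Beta.FP.PerfectSymbolPerm (cflip cflip_apply W166Inf_cflip)
open Summit.QuantumFields.BalabanUV.Beta.FP.PerfectPropagatorSymbol (curlRow maxwellMat feynMat PinfSym feynMat_isHermitian)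
open Summit.QuantumFields.BalabanUV.Beta.FP.PerfectPropagatorKernel (symB KB symB_ofRealVec)
open Summit.QuantumFields.BalabanUV.Beta.GAN24.LatticeKernelReality (ofRealVec_neg latticeKernel_reflect latticeKernel_im_eq_zero latticeKernel_eq_re)
open Summit.QuantumFields.BalabanUV.Beta.GAN24.DirichletExhaustionDeltaZSymm (latticeKernel_congr_BZ)

variable {d : ℕ}

/-! ## §1 `W_∞` is even -/

/-- [folklore] flipping the coordinates of a `Finset` leaves `W_∞` invariant (`W166Inf_cflip` one coordinate at a time). -/
theorem W166Inf_flipSet (μ ν : Fin (d + 1)) (p : Fin (d + 1) → ℂ) (S : Finset (Fin (d + 1))) :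
    W166Inf μ ν (fun i => if i ∈ S then -p i else p i) = W166Inf μ ν p := by
  induction S using Finset.induction_on with
  | empty => simp
  | @insert a S ha ih =>
    have e : (fun i => if i ∈ insert a S then -p i else p i) = cflip a (fun i => if i ∈ S then -p i else p i) := by
      funext i
      by_cases hia : i = a
      · subst hia; simp [ha]
      · simp [hia]
    rw [e, W166Inf_cflip, ih]

/-- [folklore] **`W_∞(μ,ν; −p) = W_∞(μ,ν; p)`** for every complex momentum `p`. -/
theorem W166Inf_neg (μ ν : Fin (d + 1)) (p : Fin (d + 1) → ℂ) : W166Inf μ ν (-p) = W166Inf μ ν p := by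
  have e : (-p) = fun i => if i ∈ (Finset.univ : Finset (Fin (d + 1))) then -p i else p i := by
    funext i; simp
  rw [e]; exact W166Inf_flipSet μ ν p _

/-! ## §2 The conjugation structure of the symbol -/

/-- [folklore] `p̂(−s) = conj p̂(s)`: `e^{−is_a} − 1 = conj (e^{is_a} − 1)`. -/
theorem d1Sym_neg (s : Fin (d + 1) → ℝ) : d1Sym (-s) = star (d1Sym s) := by
  funext a
  simp only [d1Sym, Pi.neg_apply, Pi.star_apply, Complex.ofReal_neg, star_sub, star_one, Complex.star_def, ← Complex.exp_conj,
    map_mul, Complex.conj_ofReal, Complex.conj_I]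
  ring_nf

/-- [folklore] the curl row is conjugate-linear under `ph ↦ conj ph`. -/
theorem curlRow_star (ph : Fin (d + 1) → ℂ) (μ ν α : Fin (d + 1)) : curlRow (star ph) μ ν α = conj (curlRow ph μ ν α) := by
  unfold curlRow
  split_ifs <;> simp

/-- [folklore] `maxwellMat W (conj ph) = conj ∘ maxwellMat W ph` (real weights). -/
theorem maxwellMat_star (W : Fin (d + 1) → Fin (d + 1) → ℝ) (ph : Fin (d + 1) → ℂ) :
    maxwellMat W (star ph) = (maxwellMat W ph).map conj := by
  ext α β
  simp only [maxwellMat, Matrix.map_apply, map_sum]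
  refine Finset.sum_congr rfl fun μ _ => Finset.sum_congr rfl fun ν _ => ?_
  split_ifs
  · simp
  · rw [curlRow_star, curlRow_star, map_mul, map_mul, Complex.conj_conj, Complex.conj_ofReal]

/-- [folklore] `feynMat W (conj ph) = conj ∘ feynMat W ph`. -/
theorem feynMat_star (W : Fin (d + 1) → Fin (d + 1) → ℝ) (ph : Fin (d + 1) → ℂ) :
    feynMat W (star ph) = (feynMat W ph).map conj := by
  ext α β
  have h := congrFun (congrFun (maxwellMat_star W ph) α) β
  simp only [Matrix.map_apply] at h
  simp only [feynMat, Matrix.map_apply, h, map_add, map_mul, Complex.conj_conj, Pi.star_apply, Complex.star_def]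

/-- [folklore] entrywise conjugation is `ᴴ` followed by `ᵀ`. -/
theorem map_conj_eq_conjTranspose_transpose {n : Type*} (M : Matrix n n ℂ) : M.map conj = Mᴴᵀ := by
  ext i j; simp [Matrix.conjTranspose_apply]

/-- [folklore] entrywise conjugation commutes with the matrix inverse. -/
theorem inv_map_conj {n : Type*} [Fintype n] [DecidableEq n] (M : Matrix n n ℂ) : (M.map conj)⁻¹ = M⁻¹.map conj := by
  rw [map_conj_eq_conjTranspose_transpose, map_conj_eq_conjTranspose_transpose, ← transpose_nonsing_inv, ← conjTranspose_nonsing_inv]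

/-- [our object] **`PinfSym (−s) (p̂(−s)) = conj ∘ PinfSym s (p̂ s)`** (even weights, conjugate momentum factors, conjugate inverse). -/
theorem PinfSym_neg (s : Fin (d + 1) → ℝ) : PinfSym (-s) (d1Sym (-s)) = (PinfSym s (d1Sym s)).map conj := by
  unfold PinfSym
  have hw : (fun μ ν => (W166Inf μ ν (ofRealVec (-s))).re) = fun μ ν => (W166Inf μ ν (ofRealVec s)).re := by
    funext μ ν; rw [ofRealVec_neg, W166Inf_neg]
  rw [hw, d1Sym_neg, feynMat_star, inv_map_conj]

/-- [folklore] the dispersion is even. -/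
theorem dispersion_neg (s : Fin (d + 1) → ℝ) : dispersion (-s) = dispersion s := by
  simp [dispersion, Real.cos_neg]

/-- [our object] **`B(−s) = conj B(s)`** on real momenta. -/
theorem symB_ofRealVec_neg (α β : Fin (d + 1)) (s : Fin (d + 1) → ℝ) : symB α β (ofRealVec (-s)) = conj (symB α β (ofRealVec s)) := by
  rw [symB_ofRealVec, symB_ofRealVec, PinfSym_neg, dispersion_neg, Matrix.map_apply, map_sub]
  congr 1
  split_ifs
  · rw [Complex.conj_ofReal]
  · rw [map_zero]

/-- [our object] **`conj (B_{αβ}(s)) = B_{βα}(s)`** (Hermitian `PinfSym`, real diagonal free part). -/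
theorem conj_symB_ofRealVec (α β : Fin (d + 1)) (s : Fin (d + 1) → ℝ) : conj (symB α β (ofRealVec s)) = symB β α (ofRealVec s) := by
  rw [symB_ofRealVec, symB_ofRealVec, map_sub]
  have hH : (PinfSym s (d1Sym s)).IsHermitian := by unfold PinfSym; exact (feynMat_isHermitian _ _).inv
  have h := hH.apply β α
  rw [Complex.star_def] at h
  rw [h]
  congr 1
  by_cases hab : α = β
  · subst hab; simp only [if_true, Complex.conj_ofReal]
  · rw [if_neg hab, if_neg (Ne.symm hab), map_zero]

/-! ## §3 (K4) Reality and reflection of the remainder kernel -/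

/-- [our object] `Im (KB α β z) = 0` — the real-zone symmetry `conj B(−s) = B(s)` fed to `LatticeKernelReality.latticeKernel_im_eq_zero`. -/
theorem im_KB (α β : Fin (d + 1)) (z : Fin (d + 1) → ℤ) : (KB α β z).im = 0 :=
  latticeKernel_im_eq_zero (G := symB α β) (fun s _ => by rw [symB_ofRealVec_neg, Complex.conj_conj]) z

/-- [our object] **(K4, reality) `conj (KB α β z) = KB α β z`.** -/
theorem conj_KB (α β : Fin (d + 1)) (z : Fin (d + 1) → ℤ) : conj (KB α β z) = KB α β z :=
  Complex.conj_eq_iff_im.mpr (im_KB α β z)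

/-- [our object] `KB α β z = Re (KB α β z)` as a complex number. -/
theorem KB_eq_re (α β : Fin (d + 1)) (z : Fin (d + 1) → ℤ) : KB α β z = ((((KB α β z).re : ℝ)) : ℂ) :=
  latticeKernel_eq_re (G := symB α β) (fun s _ => by rw [symB_ofRealVec_neg, Complex.conj_conj]) z

/-- [our object] **(K4, reflection) `KB α β (−z) = KB β α z`** (`latticeKernel_reflect` + `B_{αβ}(−s) = conj B_{αβ}(s) = B_{βα}(s)`). -/
theorem KB_neg (α β : Fin (d + 1)) (z : Fin (d + 1) → ℤ) : KB α β (-z) = KB β α z := by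
  unfold KB
  rw [← latticeKernel_reflect]
  refine latticeKernel_congr_BZ (fun s _ => ?_) z
  show symB α β (-ofRealVec s) = symB β α (ofRealVec s)
  rw [← ofRealVec_neg, symB_ofRealVec_neg, conj_symB_ofRealVec]

end Summit.QuantumFields.BalabanUV.Beta.FP.PerfectPropagatorKernelSymm

end
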